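import Mathlib
import HarnessLib
import Summits.Ventures.LatticeQCDFlow.Exactness.U1FTHMCGaugeCovariance

/-!
# The `U(1)` FT-HMC kernel commutes with LATTICE TRANSLATIONS (translation-equivariant member, invariant booked density and action, translation-covariant force routine)

HONEST FRAMING: exact (Metropolis-corrected) sampling algorithms for lattice gauge theory;
figures of merit are autocorrelation/cost numbers at stated couplings and volumes; no
continuum-physics claim.

Venture `LatticeQCDFlow` (cell pub-lqcd), topic `Exactness`; FANOUT row 14 (`eng-flowhmc`, `U(1)`
rung: links `GaugeConfig d L U(1)`, momenta `Edge d L → ℝ`, drift `V_e ← e^{icp_e} V_e`).  NEW WORK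
of the cell; nothing is cited as a fact; no number.  The abelian twin of
`SU2FTHMCTranslationCovariance`: a translation `a : Site d L` re-indexes links and momenta alike,
`(V·a)(x, μ) = V(x+a, μ)`, `(p·a)(x, μ) = p(x+a, μ)` (a coordinate permutation: additive, odd,
`volume_measurePreserving_piCongrLeft`, kinetic energy by `Fintype.sum_equiv`; the drift commutes
definitionally), and `FTHMCKernelCovariance.gauge_fthmc_conjKernel_eq_self` gives:

* **`u1_fthmc_conjKernel_translate`** — translation-equivariant member `F`, translation-invariant
  measurable `J`, `S`, translation-covariant measurable force routine, any `c`, `n`: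
  `conjKernel K Θ_a = K` for the engine's `U(1)` FT-HMC configuration kernel;
* **`u1_fthmc_apply_translate`**, **`u1_fthmc_lawIterate_translate`** — transition probabilities and
  the whole run translate.

NOT CLAIMED: translation-equivariance of the engine's parity-masked `U(1)` members (even translations
only; not typed); the exact force under translations on this rung (the `SU(2)` argument of
`SU2ExactForceTranslationCovariance` applies verbatim; not typed); any number.
-/

noncomputable section

namespace Summit.Ventures.LatticeQCDFlow.Exactness

open Set MeasureTheory
open ProbabilityTheory ProbabilityTheory.Kernel
open Literature.MathematicalPhysics.QuantumFieldTheory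
open scoped ENNReal

variable {d L : ℕ} [NeZero L]

/-- **The engine's `U(1)` FT-HMC configuration kernel commutes with every lattice translation.** -/
theorem u1_fthmc_conjKernel_translate (a : Site d L)
    (F : GaugeConfig d L Circle ≃ᵐ GaugeConfig d L Circle) (hF : ∀ V : GaugeConfig d L Circle, F (fun e : Edge d L => V (e.1 + a, e.2)) = (fun e : Edge d L => (F V) (e.1 + a, e.2)))
    {J : GaugeConfig d L Circle → ℝ} (hJm : Measurable J) (hJ : ∀ V : GaugeConfig d L Circle, J (fun e : Edge d L => V (e.1 + a, e.2)) = J V)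
    {S : GaugeConfig d L Circle → ℝ} (hS : Measurable S) (hSi : ∀ V : GaugeConfig d L Circle, S (fun e : Edge d L => V (e.1 + a, e.2)) = S V) (c : ℝ)
    {g : GaugeConfig d L Circle → (Edge d L → ℝ)} (hg : Measurable g)
    (hgc : ∀ V : GaugeConfig d L Circle, g (fun e : Edge d L => V (e.1 + a, e.2)) = (fun e : Edge d L => (g V) (e.1 + a, e.2))) (n : ℕ) :
    conjKernel
      (conjKernel
        (refreshUpdate
          (involMH
            (⇑((flip : Equiv.Perm (GaugeConfig d L Circle × (Edge d L → ℝ))) *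
                leapfrog (mulDrift (fun p : Edge d L → ℝ => fun i : Edge d L => Circle.exp (c * p i))) g ^ n))
            (measurable_flip_leapfrog_pow (measurable_mulDrift (measurable_circleDrift c)) hg n)
            fun z : GaugeConfig d L Circle × (Edge d L → ℝ) =>
              (S (F z.1) - Real.log (J z.1)) + ∑ i, z.2 i ^ 2 / 2)
          ((((volume : Measure (Edge d L → ℝ)).withDensity
                  fun p => ENNReal.ofReal (Real.exp (-(∑ i, p i ^ 2 / 2)))) Set.univ)⁻¹ •
              (volume : Measure (Edge d L → ℝ)).withDensity
                fun p => ENNReal.ofReal (Real.exp (-(∑ i, p i ^ 2 / 2)))))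
        F)
      ({ toFun := fun V : GaugeConfig d L Circle => (fun e : Edge d L => V (e.1 + a, e.2)),
         invFun := fun V : GaugeConfig d L Circle => (fun e : Edge d L => V (e.1 - a, e.2)),
         left_inv := fun V => funext fun e => by simp only [sub_add_cancel],
         right_inv := fun V => funext fun e => by simp only [add_sub_cancel_right],
         measurable_toFun := measurable_pi_lambda _ fun e => measurable_pi_apply _,
         measurable_invFun := measurable_pi_lambda _ fun e => measurable_pi_apply _ } : GaugeConfig d L Circle ≃ᵐ GaugeConfig d L Circle) =
      (conjKernel
        (refreshUpdate
          (involMH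
            (⇑((flip : Equiv.Perm (GaugeConfig d L Circle × (Edge d L → ℝ))) *
                leapfrog (mulDrift (fun p : Edge d L → ℝ => fun i : Edge d L => Circle.exp (c * p i))) g ^ n))
            (measurable_flip_leapfrog_pow (measurable_mulDrift (measurable_circleDrift c)) hg n)
            fun z : GaugeConfig d L Circle × (Edge d L → ℝ) =>
              (S (F z.1) - Real.log (J z.1)) + ∑ i, z.2 i ^ 2 / 2)
          ((((volume : Measure (Edge d L → ℝ)).withDensity
                  fun p => ENNReal.ofReal (Real.exp (-(∑ i, p i ^ 2 / 2)))) Set.univ)⁻¹ •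
              (volume : Measure (Edge d L → ℝ)).withDensity
                fun p => ENNReal.ofReal (Real.exp (-(∑ i, p i ^ 2 / 2)))))
        F) := by
  let σ : (Edge d L) ≃ (Edge d L) := (Equiv.prodCongr (Equiv.addRight a) (Equiv.refl (Fin d)))
  let R : (Edge d L → ℝ) ≃ᵐ (Edge d L → ℝ) := MeasurableEquiv.piCongrLeft (fun _ : Edge d L => ℝ) σ.symm
  have hRapply : ∀ p : (Edge d L → ℝ), R p = (fun e : Edge d L => p (e.1 + a, e.2)) := by
    intro p
    funext e
    change (Equiv.piCongrLeft (fun _ : Edge d L => ℝ) σ.symm) p e = _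
    rw [Equiv.piCongrLeft_apply_eq_cast, cast_eq]
    rfl
  have hRneg : ∀ p, R (-p) = -R p := fun p => by
    rw [hRapply, hRapply]
    rfl
  have hRadd : ∀ p p', R (p + p') = R p + R p' := fun p p' => by
    rw [hRapply, hRapply, hRapply]
    rfl
  have he : ∀ (p : (Edge d L → ℝ)) (V : GaugeConfig d L Circle),
      (fun p : Edge d L → ℝ => fun i : Edge d L => Circle.exp (c * p i)) (R p) *
      ({ toFun := fun V : GaugeConfig d L Circle => (fun e : Edge d L => V (e.1 + a, e.2)),
         invFun := fun V : GaugeConfig d L Circle => (fun e : Edge d L => V (e.1 - a, e.2)),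
         left_inv := fun V => funext fun e => by simp only [sub_add_cancel],
         right_inv := fun V => funext fun e => by simp only [add_sub_cancel_right],
         measurable_toFun := measurable_pi_lambda _ fun e => measurable_pi_apply _,
         measurable_invFun := measurable_pi_lambda _ fun e => measurable_pi_apply _ } : GaugeConfig d L Circle ≃ᵐ GaugeConfig d L Circle) V =
      ({ toFun := fun V : GaugeConfig d L Circle => (fun e : Edge d L => V (e.1 + a, e.2)),
         invFun := fun V : GaugeConfig d L Circle => (fun e : Edge d L => V (e.1 - a, e.2)),
         left_inv := fun V => funext fun e => by simp only [sub_add_cancel],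
         right_inv := fun V => funext fun e => by simp only [add_sub_cancel_right],
         measurable_toFun := measurable_pi_lambda _ fun e => measurable_pi_apply _,
         measurable_invFun := measurable_pi_lambda _ fun e => measurable_pi_apply _ } : GaugeConfig d L Circle ≃ᵐ GaugeConfig d L Circle) ((fun p : Edge d L → ℝ => fun i : Edge d L => Circle.exp (c * p i)) p * V) := fun p V => by
    rw [hRapply]
    rfl
  have hgΘ : ∀ V : GaugeConfig d L Circle, g (
      ({ toFun := fun V : GaugeConfig d L Circle => (fun e : Edge d L => V (e.1 + a, e.2)),
         invFun := fun V : GaugeConfig d L Circle => (fun e : Edge d L => V (e.1 - a, e.2)),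
         left_inv := fun V => funext fun e => by simp only [sub_add_cancel],
         right_inv := fun V => funext fun e => by simp only [add_sub_cancel_right],
         measurable_toFun := measurable_pi_lambda _ fun e => measurable_pi_apply _,
         measurable_invFun := measurable_pi_lambda _ fun e => measurable_pi_apply _ } : GaugeConfig d L Circle ≃ᵐ GaugeConfig d L Circle) V) = R (g V) := fun V => by
    rw [hRapply]
    exact hgc V
  have hTR : ∀ p : (Edge d L → ℝ), (fun p : (Edge d L → ℝ) => ∑ i, p i ^ 2 / 2) (R p) = (fun p : (Edge d L → ℝ) => ∑ i, p i ^ 2 / 2) p := by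
    intro p
    change ∑ i, (R p) i ^ 2 / 2 = ∑ i, p i ^ 2 / 2
    rw [hRapply]
    exact Fintype.sum_equiv σ _ _ (fun e => rfl)
  have hRν : MeasurePreserving R (volume : Measure (Edge d L → ℝ)) volume :=
    volume_measurePreserving_piCongrLeft (fun _ : Edge d L => ℝ) σ.symm
  exact gauge_fthmc_conjKernel_eq_self (Q := GaugeConfig d L Circle) (P := (Edge d L → ℝ)) (ν := (volume : Measure (Edge d L → ℝ)))
    (e := (fun p : Edge d L → ℝ => fun i : Edge d L => Circle.exp (c * p i))) (g := g) (S := S) (T := fun p : (Edge d L → ℝ) => ∑ i, p i ^ 2 / 2) (J := J)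
    (measurable_circleDrift c) hg n hS measurable_piGaussianKinetic F hJm
    ({ toFun := fun V : GaugeConfig d L Circle => (fun e : Edge d L => V (e.1 + a, e.2)),
         invFun := fun V : GaugeConfig d L Circle => (fun e : Edge d L => V (e.1 - a, e.2)),
         left_inv := fun V => funext fun e => by simp only [sub_add_cancel],
         right_inv := fun V => funext fun e => by simp only [add_sub_cancel_right],
         measurable_toFun := measurable_pi_lambda _ fun e => measurable_pi_apply _,
         measurable_invFun := measurable_pi_lambda _ fun e => measurable_pi_apply _ } : GaugeConfig d L Circle ≃ᵐ GaugeConfig d L Circle) R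
    hRneg hRadd he hgΘ (fun V => hF V) (fun V => hSi V) (fun V => hJ V) hTR hRν

/-- **Transition probabilities translate**: `K (V·a, A) = K (V, {U | U·a ∈ A})`. -/
theorem u1_fthmc_apply_translate (a : Site d L)
    (F : GaugeConfig d L Circle ≃ᵐ GaugeConfig d L Circle) (hF : ∀ V : GaugeConfig d L Circle, F (fun e : Edge d L => V (e.1 + a, e.2)) = (fun e : Edge d L => (F V) (e.1 + a, e.2)))
    {J : GaugeConfig d L Circle → ℝ} (hJm : Measurable J) (hJ : ∀ V : GaugeConfig d L Circle, J (fun e : Edge d L => V (e.1 + a, e.2)) = J V)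
    {S : GaugeConfig d L Circle → ℝ} (hS : Measurable S) (hSi : ∀ V : GaugeConfig d L Circle, S (fun e : Edge d L => V (e.1 + a, e.2)) = S V) (c : ℝ)
    {g : GaugeConfig d L Circle → (Edge d L → ℝ)} (hg : Measurable g)
    (hgc : ∀ V : GaugeConfig d L Circle, g (fun e : Edge d L => V (e.1 + a, e.2)) = (fun e : Edge d L => (g V) (e.1 + a, e.2))) (n : ℕ)
    (u : GaugeConfig d L Circle) {A : Set (GaugeConfig d L Circle)} (hA : MeasurableSet A) :
    (conjKernel
      (refreshUpdate
        (involMH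
          (⇑((flip : Equiv.Perm (GaugeConfig d L Circle × (Edge d L → ℝ))) *
              leapfrog (mulDrift (fun p : Edge d L → ℝ => fun i : Edge d L => Circle.exp (c * p i))) g ^ n))
          (measurable_flip_leapfrog_pow (measurable_mulDrift (measurable_circleDrift c)) hg n)
          fun z : GaugeConfig d L Circle × (Edge d L → ℝ) =>
            (S (F z.1) - Real.log (J z.1)) + ∑ i, z.2 i ^ 2 / 2)
        ((((volume : Measure (Edge d L → ℝ)).withDensity
                  fun p => ENNReal.ofReal (Real.exp (-(∑ i, p i ^ 2 / 2)))) Set.univ)⁻¹ •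
              (volume : Measure (Edge d L → ℝ)).withDensity
                fun p => ENNReal.ofReal (Real.exp (-(∑ i, p i ^ 2 / 2)))))
      F)
      (fun e : Edge d L => u (e.1 + a, e.2)) A =
    (conjKernel
      (refreshUpdate
        (involMH
          (⇑((flip : Equiv.Perm (GaugeConfig d L Circle × (Edge d L → ℝ))) *
              leapfrog (mulDrift (fun p : Edge d L → ℝ => fun i : Edge d L => Circle.exp (c * p i))) g ^ n))
          (measurable_flip_leapfrog_pow (measurable_mulDrift (measurable_circleDrift c)) hg n)
          fun z : GaugeConfig d L Circle × (Edge d L → ℝ) =>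
            (S (F z.1) - Real.log (J z.1)) + ∑ i, z.2 i ^ 2 / 2)
        ((((volume : Measure (Edge d L → ℝ)).withDensity
                  fun p => ENNReal.ofReal (Real.exp (-(∑ i, p i ^ 2 / 2)))) Set.univ)⁻¹ •
              (volume : Measure (Edge d L → ℝ)).withDensity
                fun p => ENNReal.ofReal (Real.exp (-(∑ i, p i ^ 2 / 2)))))
      F)
      u ((fun V : GaugeConfig d L Circle => (fun e : Edge d L => V (e.1 + a, e.2))) ⁻¹' A) :=
  apply_eq_of_conjKernel_eq_self (u1_fthmc_conjKernel_translate a F hF hJm hJ hS hSi c hg hgc n) u hA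

/-- **The whole run translates** at every time. -/
theorem u1_fthmc_lawIterate_translate (a : Site d L)
    (F : GaugeConfig d L Circle ≃ᵐ GaugeConfig d L Circle) (hF : ∀ V : GaugeConfig d L Circle, F (fun e : Edge d L => V (e.1 + a, e.2)) = (fun e : Edge d L => (F V) (e.1 + a, e.2)))
    {J : GaugeConfig d L Circle → ℝ} (hJm : Measurable J) (hJ : ∀ V : GaugeConfig d L Circle, J (fun e : Edge d L => V (e.1 + a, e.2)) = J V)
    {S : GaugeConfig d L Circle → ℝ} (hS : Measurable S) (hSi : ∀ V : GaugeConfig d L Circle, S (fun e : Edge d L => V (e.1 + a, e.2)) = S V) (c : ℝ)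
    {g : GaugeConfig d L Circle → (Edge d L → ℝ)} (hg : Measurable g)
    (hgc : ∀ V : GaugeConfig d L Circle, g (fun e : Edge d L => V (e.1 + a, e.2)) = (fun e : Edge d L => (g V) (e.1 + a, e.2))) (n : ℕ)
    (μ₀ : Measure (GaugeConfig d L Circle)) (t : ℕ) :
    (fun m : Measure (GaugeConfig d L Circle) => m.bind
      (conjKernel
        (refreshUpdate
          (involMH
            (⇑((flip : Equiv.Perm (GaugeConfig d L Circle × (Edge d L → ℝ))) *
                leapfrog (mulDrift (fun p : Edge d L → ℝ => fun i : Edge d L => Circle.exp (c * p i))) g ^ n))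
            (measurable_flip_leapfrog_pow (measurable_mulDrift (measurable_circleDrift c)) hg n)
            fun z : GaugeConfig d L Circle × (Edge d L → ℝ) =>
              (S (F z.1) - Real.log (J z.1)) + ∑ i, z.2 i ^ 2 / 2)
          ((((volume : Measure (Edge d L → ℝ)).withDensity
                  fun p => ENNReal.ofReal (Real.exp (-(∑ i, p i ^ 2 / 2)))) Set.univ)⁻¹ •
              (volume : Measure (Edge d L → ℝ)).withDensity
                fun p => ENNReal.ofReal (Real.exp (-(∑ i, p i ^ 2 / 2)))))
        F))^[t]
      (μ₀.map (fun V : GaugeConfig d L Circle => (fun e : Edge d L => V (e.1 + a, e.2)))) =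
    ((fun m : Measure (GaugeConfig d L Circle) => m.bind
      (conjKernel
        (refreshUpdate
          (involMH
            (⇑((flip : Equiv.Perm (GaugeConfig d L Circle × (Edge d L → ℝ))) *
                leapfrog (mulDrift (fun p : Edge d L → ℝ => fun i : Edge d L => Circle.exp (c * p i))) g ^ n))
            (measurable_flip_leapfrog_pow (measurable_mulDrift (measurable_circleDrift c)) hg n)
            fun z : GaugeConfig d L Circle × (Edge d L → ℝ) =>
              (S (F z.1) - Real.log (J z.1)) + ∑ i, z.2 i ^ 2 / 2)
          ((((volume : Measure (Edge d L → ℝ)).withDensity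
                  fun p => ENNReal.ofReal (Real.exp (-(∑ i, p i ^ 2 / 2)))) Set.univ)⁻¹ •
              (volume : Measure (Edge d L → ℝ)).withDensity
                fun p => ENNReal.ofReal (Real.exp (-(∑ i, p i ^ 2 / 2)))))
        F))^[t] μ₀).map (fun V : GaugeConfig d L Circle => (fun e : Edge d L => V (e.1 + a, e.2))) :=
  iterate_bind_map_of_conjKernel_eq_self
    (u1_fthmc_conjKernel_translate a F hF hJm hJ hS hSi c hg hgc n) μ₀ t

end Summit.Ventures.LatticeQCDFlow.Exactness
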